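import Summits.QuantumFields.BalabanUV.T4Continuum.Support.NE7TensionGaugeLetter
import Summits.QuantumFields.BalabanUV.T4Continuum.Support.MinimalActionClassSix
import Literature.MathematicalPhysics.QuantumFieldTheory.Balaban1983to89.B8Ineq132
import HarnessLib

/-!
# NE7CovDivB8Letter — [B8] (1.2)∕(1.9) LITERALLY: lit-balaban's typed covariant divergence `B8Ineq132.covDiv η U μ x` of the plaquette field
# `(∂U)(p) = U(∂p)` IS (`η⁻¹` times) the covariant tension of the antisymmetrised DEVIATION form `U(∂p) − 1`, hence within `8d·a²` of the log-chart tension of R2;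
# so at a tangent-critical admissible configuration `‖covDiv η U μ x₀‖ ≤ |η|⁻¹·(card n·K + 8d·a²)` at every bond of the period box, in every unitary gauge

Cell `pub-balaban`, rung (B)+1 sub-cell t4, lineage `b2b-balaban-t4-ne7-p1`, generation 72 (CRUX PROVER NE7 #1, OWNER row NE7).  File R4 of the REP♭ road (memo §7 (R-a),
§9): the one-file dictionary between the tree's first-variation objects (gen 62's tension `Σ_μ cDstar U μ (B·μν) x` of `NE7TensionPairing`, R2
`NE7CriticalTensionLetter`, R3 `NE7TensionGaugeLetter`) and the PRINTED (1.2) «`(D^{η*}_U ∂U)_μ(x) = Σ_{ν<μ}(D^{η*}_{U,ν}F_{νμ})(x) − Σ_{ν>μ}(D^{η*}_{U,ν}F_{μν})(x)`» as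
typed in lit-balaban (`B8Ineq132.covDiv`, SAME carriers `Site d → Fin d → 𝔸ˣ`, `plaqF V μ ν x = V(∂p_{μν}(x))` = T4's `fhol V (x; μ<ν)`, `conjR = Ad`), so that
[Balaban1985RegularSpaces] (1.9) «`|(D*_U ∂U)(b)| < α₀L^{−2j}(Lʲη)^{−1}`» (`B8Ineq132.CondAt`'s second clause) is available for a tangent-critical configuration in
the vocabulary [B8] Theorem 2 is typed in (`B8Eq133Hypotheses.Hyp134` ∋ `InAk` ∋ `CondAt`).
WHAT ([folklore]; 0 def, 0 sorry; every dimension `d`).  §1 (`conjR_eq_Ad` is `MinimalActionClassSix`'s, BY NAME), `plaqF_eq_fhol`, `Iio_eq_filter`, `Ioi_eq_filter`; **`smul_covDiv_eq_tension_devForm`**: for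
`η ≠ 0` and the antisymmetrised deviation form `D` (`D_{νμ}(y) = V(∂p_{νμ}(y)) − 1` for `ν < μ`), `η • covDiv η V μ x = Σ_ν cDstar V ν (D·νμ) x` EXACTLY (the `1`s cancel
under `Ad`; for `ν > μ` the printed minus sign is the antisymmetry `F_{μν} ↔ −F_{νμ}` read on deviations).  §2 `norm_tension_devForm_sub_le` (`‖T[D] − T[B]‖ ≤ 8d·a²`, R3's
`norm_devForm_sub_fluxForm_le`); **`norm_covDiv_le_of_tanCritical`**: under R2's hypotheses, for every unitary site gauge `u` and `η ≠ 0`: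
`‖covDiv η (U^u) μ x₀‖ ≤ |η|⁻¹·(card n·(c_R(Λ + (L∕L^d)^{k+1}) + 12·#Plane·a²) + 8d·a²)` at every bond `(x₀ ∈ periodBox, μ)` — with `η = M⁻¹`, `a = δM⁻²`:
`≤ M·(card n·C(1+2C_Sα̂)δM⁻³ + O(δ²M⁻⁴)) = α·M⁻²` with `α ∝ δ`, i.e. `CondAt`'s threshold `α(Lʲ)⁻²(Lʲη)⁻¹` at the top level `Lʲη = 1`.
HONEST FRAMING (page 1): an IDENTITY plus R2∕R3 re-read; the (1.9) INPUT of [B8] Theorem 2 in the printed vocabulary, NOT that theorem (whose nonlinear `U(N)` form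
on the T4 carriers is NOT in the tree); REP♭ NOT proved; (APE) NOT proved unconditionally; NOT ONE-STEP, NOT NE7; spine 0∕9; finite T⁴ rung (B)+1 — NOT infinite
volume, NOT mass gap, NOT Clay.  Continuum YM on T⁴ ⇐ BetaPertH ∧ nine spine estimates (0/9 proved); BetaPertH ⇐ (D1) ∧ (D4) ∧ CAP+tail; G-an2-4 gates asym,
D1 and NE2/3/4.
-/

set_option autoImplicit false

open scoped BigOperators Matrix.Norms.L2Operator
open NormedSpace Finset

namespace Summit.QuantumFields.BalabanUV.T4Continuum.NE7CovDivB8Letter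

open Literature.MathematicalPhysics.QuantumFieldTheory.Balaban1983to89
open B7Prop1Explicit B7Prop2Explicit MatrixLog UnitaryModel MatrixNorms
open B7Eq78Linearization (conjR conjR_apply)
open B8Ineq132 (plaqF covDeriv covDiv)
open T4AveragingDeficitWall (IsUnitaryCfg IsSkewDir SmallField dirL1 Ad flux fhol)
open T4AveragingDeficitWallBoundary (IsPeriodicCfg periodBox)
open T4AveragingDeficitNonAbelian (Ad_mul Ad_sub)
open AveragingDeficitTransport (norm_Ad_of_unitary)
open AveragingDeficitNearIdentity (Ad_one Ad_neg Ad_add)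
open AveragingDeficitPeriodicCounting (IsPeriodicDir)
open AveragingDeficitMultiLevelPrep (cavgIter LevelSmall)
open AveragingDeficitKDatum (isUnitaryCfg_gaugeAct)
open BlockAverageCurrent (smallField_gaugeAct)
open MinimalActionLevels (perWin)
open BlockAveragePushDirSplit (flat)
open NE3TangentCovariantTower (dirIter QbarIter)
open NE3HessForm (dAction)
open NE3CovariantCalculus (cDstar)
open MinimalActionClassSix (conjR_eq_Ad)
open NE3QbarIterCovLiftPrep (cruxC)
open NE3RightInverseSolveLetters (thetaLoc)
open NE3HatInvCurlLetters (curl1C)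
open NE7FluxGradientFromTension (exists_fluxForm fluxForm_diag)
open NE7TensionGaugeLetter (norm_tension_gaugeAct_le_of_tanCritical norm_devForm_sub_fluxForm_le)

noncomputable section

variable {d : ℕ} {n : Type*} [Fintype n] [DecidableEq n]

/-! ## §1 The dictionary and the identity -/

/-- lit-balaban's plaquette field `plaqF V μ ν x = V(∂p_{μν}(x))` IS the tree's `fhol V (x; μ<ν)`. [folklore] -/
theorem plaqF_eq_fhol (V : Site d → Fin d → (Matrix n n ℂ)ˣ) (x : Site d) {μ ν : Fin d} (h : μ < ν) :
    plaqF V μ ν x = ((fhol V (x, ⟨(μ, ν), h⟩) : (Matrix n n ℂ)ˣ) : Matrix n n ℂ) := rfl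

omit [Fintype n] [DecidableEq n] in
/-- `Iio μ` as a filter of `univ`. [folklore] -/
theorem Iio_eq_filter (μ : Fin d) : Finset.Iio μ = Finset.univ.filter (fun ν => ν < μ) := by
  ext ν; simp

omit [Fintype n] [DecidableEq n] in
/-- `Ioi μ` as a filter of `univ`. [folklore] -/
theorem Ioi_eq_filter (μ : Fin d) : Finset.Ioi μ = Finset.univ.filter (fun ν => μ < ν) := by
  ext ν; simp

/-- The existence of the antisymmetrised deviation form. [folklore] -/
theorem exists_devForm (V : Site d → Fin d → (Matrix n n ℂ)ˣ) :
    ∃ D : Site d → Fin d → Fin d → Matrix n n ℂ,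
      (∀ (y : Site d) (μ ν : Fin d) (h : μ < ν), D y μ ν = ((fhol V (y, ⟨(μ, ν), h⟩) : (Matrix n n ℂ)ˣ) : Matrix n n ℂ) - 1) ∧
      (∀ (y : Site d) (μ ν : Fin d), D y ν μ = -D y μ ν) := by
  classical
  refine ⟨fun y μ ν => if h : μ < ν then ((fhol V (y, ⟨(μ, ν), h⟩) : (Matrix n n ℂ)ˣ) : Matrix n n ℂ) - 1
      else if h' : ν < μ then -(((fhol V (y, ⟨(ν, μ), h'⟩) : (Matrix n n ℂ)ˣ) : Matrix n n ℂ) - 1) else 0,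
    fun y μ ν h => by simp [h], fun y μ ν => ?_⟩
  rcases lt_trichotomy μ ν with h | h | h
  · simp [h, lt_asymm h]
  · subst h; simp
  · simp [h, lt_asymm h]

section Identity

variable {V : Site d → Fin d → (Matrix n n ℂ)ˣ} {D : Site d → Fin d → Fin d → Matrix n n ℂ}

/-- **(1.2) IS THE COVARIANT TENSION OF THE DEVIATION FORM**: for `η ≠ 0`,
`η • covDiv η V μ x = Σ_ν cDstar V ν (D · ν μ) x` for the antisymmetrised deviation form `D` (`D_{νμ}(y) = V(∂p_{νμ}(y)) − 1`, `ν < μ`). [folklore] -/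
theorem smul_covDiv_eq_tension_devForm {η : ℝ} (hη : η ≠ 0)
    (hDF : ∀ (y : Site d) (μ ν : Fin d) (h : μ < ν), D y μ ν = ((fhol V (y, ⟨(μ, ν), h⟩) : (Matrix n n ℂ)ˣ) : Matrix n n ℂ) - 1)
    (hDanti : ∀ (y : Site d) (μ ν : Fin d), D y ν μ = -D y μ ν) (μ : Fin d) (x : Site d) :
    η • covDiv η V μ x = ∑ ν : Fin d, cDstar V ν (fun w => D w ν μ) x := by
  have hAd1 : ∀ u : (Matrix n n ℂ)ˣ, Ad u (1 : Matrix n n ℂ) = 1 := fun u => by simp [Ad]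
  have hAd0 : ∀ u : (Matrix n n ℂ)ˣ, Ad u (0 : Matrix n n ℂ) = 0 := fun u => by simp [Ad]
  -- the two kinds of terms
  have hlo : ∀ ν : Fin d, ν < μ → η • covDeriv η V ν (plaqF V ν μ) x = cDstar V ν (fun w => D w ν μ) x := by
    intro ν h
    simp only [covDeriv, cDstar]
    rw [smul_smul, mul_inv_cancel₀ hη, one_smul, conjR_eq_Ad, plaqF_eq_fhol V _ h, plaqF_eq_fhol V _ h,
      show ((fhol V (x - e ν, ⟨(ν, μ), h⟩) : (Matrix n n ℂ)ˣ) : Matrix n n ℂ) = D (x - e ν) ν μ + 1 by rw [hDF _ _ _ h, sub_add_cancel],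
      show ((fhol V (x, ⟨(ν, μ), h⟩) : (Matrix n n ℂ)ˣ) : Matrix n n ℂ) = D x ν μ + 1 by rw [hDF _ _ _ h, sub_add_cancel], Ad_add, hAd1]
    abel
  have hhi : ∀ ν : Fin d, μ < ν → -(η • covDeriv η V ν (plaqF V μ ν) x) = cDstar V ν (fun w => D w ν μ) x := by
    intro ν h
    simp only [covDeriv, cDstar]
    rw [smul_smul, mul_inv_cancel₀ hη, one_smul, conjR_eq_Ad, plaqF_eq_fhol V _ h, plaqF_eq_fhol V _ h,
      show ((fhol V (x - e ν, ⟨(μ, ν), h⟩) : (Matrix n n ℂ)ˣ) : Matrix n n ℂ) = -D (x - e ν) ν μ + 1 by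
        rw [hDanti _ _ _, neg_neg, hDF _ _ _ h, sub_add_cancel],
      show ((fhol V (x, ⟨(μ, ν), h⟩) : (Matrix n n ℂ)ˣ) : Matrix n n ℂ) = -D x ν μ + 1 by rw [hDanti _ _ _, neg_neg, hDF _ _ _ h, sub_add_cancel],
      Ad_add, Ad_neg, hAd1]
    abel
  -- the sum over `ν` splits as `ν < μ`, `ν = μ`, `μ < ν`
  have hsplit : ∀ ν : Fin d, cDstar V ν (fun w => D w ν μ) x
      = (if ν < μ then η • covDeriv η V ν (plaqF V ν μ) x else 0) + (if μ < ν then -(η • covDeriv η V ν (plaqF V μ ν) x) else 0) := by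
    intro ν
    rcases lt_trichotomy ν μ with h | h | h
    · rw [if_pos h, if_neg (lt_asymm h), add_zero, hlo ν h]
    · subst h
      rw [if_neg (lt_irrefl _), if_neg (lt_irrefl _), add_zero]
      simp only [cDstar, fluxForm_diag hDanti, hAd0, sub_zero]
    · rw [if_neg (lt_asymm h), if_pos h, zero_add, hhi ν h]
  rw [Finset.sum_congr rfl fun ν _ => hsplit ν, Finset.sum_add_distrib, ← Finset.sum_filter, ← Finset.sum_filter, ← Iio_eq_filter, ← Ioi_eq_filter,
    Finset.sum_neg_distrib, ← sub_eq_add_neg]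
  unfold covDiv
  rw [smul_sub, Finset.smul_sum, Finset.smul_sum]

end Identity

/-! ## §2 The bound at a tangent-critical configuration, in every gauge -/

/-- **`‖T[D] − T[B]‖ ≤ 8d·a²`**: the covariant tensions of the deviation form and of the flux form differ by the `4a²`-closeness per plaquette (`Ad` is an
isometry). [folklore] -/
theorem norm_tension_devForm_sub_le [Nonempty n] {V : Site d → Fin d → (Matrix n n ℂ)ˣ} (hVu : IsUnitaryCfg V) {a : ℝ} (ha4 : a ≤ 1 / 4) (hVa : SmallField V a)
    {B D : Site d → Fin d → Fin d → Matrix n n ℂ}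
    (hBF : ∀ (y : Site d) (μ ν : Fin d) (h : μ < ν), B y μ ν = flux V (y, ⟨(μ, ν), h⟩))
    (hanti : ∀ (y : Site d) (μ ν : Fin d), B y ν μ = -B y μ ν)
    (hDF : ∀ (y : Site d) (μ ν : Fin d) (h : μ < ν), D y μ ν = ((fhol V (y, ⟨(μ, ν), h⟩) : (Matrix n n ℂ)ˣ) : Matrix n n ℂ) - 1)
    (hDanti : ∀ (y : Site d) (μ ν : Fin d), D y ν μ = -D y μ ν) (x : Site d) (μ : Fin d) :
    ‖∑ ν : Fin d, cDstar V ν (fun w => D w ν μ) x - ∑ ν : Fin d, cDstar V ν (fun w => B w ν μ) x‖ ≤ 8 * (d : ℝ) * a ^ 2 := by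
  rw [← Finset.sum_sub_distrib]
  have hterm : ∀ ν : Fin d, ‖cDstar V ν (fun w => D w ν μ) x - cDstar V ν (fun w => B w ν μ) x‖ ≤ 4 * a ^ 2 + 4 * a ^ 2 := by
    intro ν
    have hw : (V (x - e ν) ν)⁻¹ ∈ unitaryUnits (Matrix n n ℂ) := (unitaryUnits _).inv_mem (hVu _ _)
    simp only [cDstar]
    rw [show Ad (V (x - e ν) ν)⁻¹ (D (x - e ν) ν μ) - D x ν μ - (Ad (V (x - e ν) ν)⁻¹ (B (x - e ν) ν μ) - B x ν μ)
        = Ad (V (x - e ν) ν)⁻¹ (D (x - e ν) ν μ - B (x - e ν) ν μ) - (D x ν μ - B x ν μ) by rw [Ad_sub]; abel]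
    refine (norm_sub_le _ _).trans (add_le_add ?_ (norm_devForm_sub_fluxForm_le ha4 hVa hBF hanti hDF hDanti _ _ _))
    rw [norm_Ad_of_unitary hw]
    exact norm_devForm_sub_fluxForm_le ha4 hVa hBF hanti hDF hDanti _ _ _
  calc ‖∑ ν : Fin d, (cDstar V ν (fun w => D w ν μ) x - cDstar V ν (fun w => B w ν μ) x)‖
      ≤ ∑ ν : Fin d, ‖cDstar V ν (fun w => D w ν μ) x - cDstar V ν (fun w => B w ν μ) x‖ := norm_sum_le _ _
    _ ≤ ∑ _ν : Fin d, (4 * a ^ 2 + 4 * a ^ 2) := Finset.sum_le_sum fun ν _ => hterm ν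
    _ = 8 * (d : ℝ) * a ^ 2 := by rw [Finset.sum_const, Finset.card_univ, Fintype.card_fin, nsmul_eq_mul]; ring

/-- **[B8] (1.9) AT A TANGENT-CRITICAL CONFIGURATION, IN lit-balaban's TYPED VOCABULARY, EVERY GAUGE**: under R2's hypotheses on `U`
(`NE7CriticalTensionLetter.norm_tension_le_of_tanCritical`), for every unitary site gauge `u` and every `η ≠ 0`, at every bond `(x₀ ∈ periodBox, μ)`:
`‖B8Ineq132.covDiv η (U^u) μ x₀‖ ≤ |η|⁻¹·(card n·(c_R(Λ + (L∕L^d)^{k+1}) + 12·#Plane·a²) + 8d·a²)`. [folklore] -/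
theorem norm_covDiv_le_of_tanCritical [Nonempty n] {L : ℕ} (hL : 2 ≤ L) (k : ℕ) {N : ℕ} [NeZero N]
    {U : Site d → Fin d → (Matrix n n ℂ)ˣ} {x a Λ : ℝ}
    (hUu : IsUnitaryCfg U) (hUP : IsPeriodicCfg U ((N * L ^ (k + 1) : ℕ) : ℤ)) (hx : 0 ≤ x) (hs : LevelSmall d L k x) (hUx : SmallField U x)
    (hθ : cruxC d L * (((L : ℝ) ^ (k + 1)) ^ 2 * x) < 1) (hθl : thetaLoc d L * (((L : ℝ) ^ (k + 1)) ^ 2 * x) < 1)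
    (hε : ((L : ℝ) ^ (k + 1)) ^ 2 * x ≤ 1) (ha : 0 ≤ a) (ha4 : a ≤ 1 / 4) (hUa : SmallField U a)
    (hflatTop : cavgIter L (k + 1) U = flat) (hΛ0 : 0 ≤ Λ)
    (hΛ : ∀ Y : Site d → Fin d → Matrix n n ℂ, IsSkewDir Y → IsPeriodicDir Y ((N * L ^ (k + 1) : ℕ) : ℤ) →
      ∑ z ∈ periodBox N, ∑ κ : Fin d, ‖QbarIter L (k + 1) U Y z κ - QbarIter L (k + 1) (flat (d := d) (n := n)) Y z κ‖
        ≤ Λ * dirL1 Y (periodBox (d := d) (N * L ^ (k + 1))))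
    (hcrit : ∀ Y' : Site d → Fin d → Matrix n n ℂ, IsSkewDir Y' → IsPeriodicDir Y' ((N * L ^ (k + 1) : ℕ) : ℤ) →
      dirIter L (k + 1) U Y' = 0 → dAction U Y' (perWin d (N * L ^ (k + 1))) = 0)
    {u : Site d → (Matrix n n ℂ)ˣ} (hu : ∀ x, u x ∈ unitaryUnits (Matrix n n ℂ)) {η : ℝ} (hη : η ≠ 0)
    {x₀ : Site d} (hx₀ : x₀ ∈ periodBox (d := d) (N * L ^ (k + 1))) (μ : Fin d) :
    ‖covDiv η (gaugeAct u U) μ x₀‖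
      ≤ |η|⁻¹ * (Fintype.card n *
          ((a * ((curl1C d L / (1 - thetaLoc d L * (((L : ℝ) ^ (k + 1)) ^ 2 * x))) * (((L : ℝ) ^ (k + 1)) ^ d / ((L : ℝ) ^ (k + 1)) ^ 2)))
              * (Λ + ((L : ℝ) / (L : ℝ) ^ d) ^ (k + 1))
            + 12 * (Fintype.card (T4AveragingDeficitWall.Plane d) : ℝ) * a ^ 2) + 8 * (d : ℝ) * a ^ 2) := by
  obtain ⟨B', hBF', hanti'⟩ := exists_fluxForm (gaugeAct u U)
  obtain ⟨D', hDF', hDanti'⟩ := exists_devForm (gaugeAct u U)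
  have hVu : IsUnitaryCfg (gaugeAct u U) := isUnitaryCfg_gaugeAct hu hUu
  have hVa : SmallField (gaugeAct u U) a := smallField_gaugeAct hu hUa
  have hT := norm_tension_gaugeAct_le_of_tanCritical hL k hUu hUP hx hs hUx hθ hθl hε ha ha4 hUa hflatTop hΛ0 hΛ hcrit hu hBF' hanti' hx₀ μ
  have hDB := norm_tension_devForm_sub_le hVu ha4 hVa hBF' hanti' hDF' hDanti' x₀ μ
  have hid := smul_covDiv_eq_tension_devForm (V := gaugeAct u U) hη hDF' hDanti' μ x₀
  have hnorm : ‖covDiv η (gaugeAct u U) μ x₀‖ = |η|⁻¹ * ‖∑ ν : Fin d, cDstar (gaugeAct u U) ν (fun w => D' w ν μ) x₀‖ := by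
    rw [← hid, norm_smul, Real.norm_eq_abs, ← mul_assoc, inv_mul_cancel₀ (abs_ne_zero.mpr hη), one_mul]
  rw [hnorm]
  refine mul_le_mul_of_nonneg_left ?_ (inv_nonneg.mpr (abs_nonneg η))
  have h3 := norm_le_norm_add_norm_sub' (∑ ν : Fin d, cDstar (gaugeAct u U) ν (fun w => D' w ν μ) x₀)
    (∑ ν : Fin d, cDstar (gaugeAct u U) ν (fun w => B' w ν μ) x₀)
  linarith

end

end Summit.QuantumFields.BalabanUV.T4Continuum.NE7CovDivB8Letter
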